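import Summits.SmoothPoincare4.SmoothPoincare4.Theorems.SymplecticOrigamiGromovRecognitionRelEndGlueDefs
import Summits.SmoothPoincare4.SmoothPoincare4.Theorems.SymplecticOrigamiGromovRecognitionRelEndWindLinAlg
import Summits.SmoothPoincare4.SmoothPoincare4.Theorems.SullivanDualWitnessChargeLimitEmbeddedLocalAux
import Literature.Geometry.Symplectic.PositivityOfIntersectionsLocal
import Literature.Geometry.Symplectic.JSphereLocalFoliationUniqueness
import Literature.Geometry.Symplectic.JHolomorphicReparametrisation
import Literature.Topology.PlaneTopology.WindingNumber
import Mathlib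

/-!
# The signed local intersection index of a `JX`-curve with an embedded `JX`-sphere
(registered helper `helper_localIndexSigned` of line `cross-cap-laurent`, crux
`GromovRecognitionRelEnd`, item stmt-SmoothPoincare4-11009; joint step J13 of the bi-foliation)

Setting: an almost complex `4`-manifold `(X, JX)`, a smooth `JX`-holomorphic map `u : ℂ → X`
through a point `u z = u' z'` of an EMBEDDED `JX`-two-chart sphere `(u', v')` carrying a normal
witness `(N, π)` (`IsNormalWitness`: `π` a smooth submersion on the open `N ⊇ im (u', v')` with zero
set exactly the image `pairImage u' v'`) whose kernels are `JX`-invariant on `N`, and with the local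
image property at `z'` (small pieces of the image near `u' z'` are images of neighbourhoods of `z'`).

Claim (`helper_localIndexSigned`): either `u` stays in the sphere near `z`, or `z` is an isolated
meeting parameter and for all small circles about `z` the winding number of `π ∘ u` is `ε · n` with
`n ≥ 1` and `n = 1` iff `d(π ∘ u)_z` is onto, where the sign `ε = ±1` of the witness at the point
is read off as the sign of `Im (dπ (JX ξ))` for any `ξ` with `dπ ξ = 1`.

Proof.  This is the vendored positivity of intersections in leaf-coordinate form
(`Literature.Geometry.Symplectic.positivityOfIntersections_leafCoordinate`, a HYPOTHESIS), applied
to the translated curves `w ↦ u (w + z)`, `w ↦ u' (w + z')` and the leaf coordinate `a := S ∘ π`,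
where the real-linear bijection `S` of `ℂ` normalises `dπ` at the point to be complex-linear for
`JX` (`helper_normalise_posDet`, after conjugating `π` first when the sign is negative,
`locIdx_normalise`).  The zero set of `a` near the point is the local image of the sphere, `da` is
onto on `N`, and the dichotomy of the fact transports back along the translation (`locIdx_F3`,
`locIdx_core`); finally `wind (S ∘ γ) = wind γ` for orientation-preserving `S`
(`helper_wind_comp_posDet`) and `wind (conj ∘ γ) = -wind γ` (`helper_wind_conj`) turn the
conclusion `wind (a ∘ u ∘ circle) ≥ 1` into the signed statement, the sign being the same for every
preimage `ξ` of `1` (`helper_orientationSign_basic`).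

References: C. Wendl, *Holomorphic Curves in Low Dimensions* (2018), §2.2.2; D. McDuff, J. Diff.
Geom. 34 (1991), Thm. 1.1 (positivity of intersections).  No new definitions, notation or instances.
-/

noncomputable section

open scoped Manifold ContDiff Topology
open Set Function Filter Literature.Geometry.Symplectic Literature.Topology.PlaneTopology
open ComplexConjugate
open Summit.SmoothPoincare4.SmoothPoincare4.Theorems.WitnessCharge.PencilIncompleteness
  (contMDiff_comp_add_const isJHolomorphic_comp_add_const)

set_option linter.dupNamespace false

namespace Summit.SmoothPoincare4.SmoothPoincare4.Theorems.GromovRecognitionRelEnd.CrossCapLaurent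

/-! ### Elementary lemmas -/

/-- The differential at `0` of the translate `x ↦ f (x + c)` is the differential of `f` at `c`. -/
theorem locIdx_mfderiv_shift {EM : Type*} [NormedAddCommGroup EM] [NormedSpace ℝ EM]
    {HM : Type*} [TopologicalSpace HM] {I : ModelWithCorners ℝ EM HM} {M : Type*}
    [TopologicalSpace M] [ChartedSpace HM M] (f : ℂ → M) (c : ℂ)
    (hf : MDifferentiableAt 𝓘(ℝ, ℂ) I f c) :
    mfderiv 𝓘(ℝ, ℂ) I (fun x => f (x + c)) 0 = mfderiv 𝓘(ℝ, ℂ) I f c := by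
  have h1 : HasMFDerivAt 𝓘(ℝ, ℂ) 𝓘(ℝ, ℂ) (fun x : ℂ => x + c) 0 (ContinuousLinearMap.id ℝ ℂ) :=
    hasMFDerivAt_iff_hasFDerivAt.2 ((hasFDerivAt_id (0 : ℂ)).add_const c)
  have hg : HasMFDerivAt 𝓘(ℝ, ℂ) I f (0 + c) (mfderiv 𝓘(ℝ, ℂ) I f c) := by
    rw [zero_add]
    exact hf.hasMFDerivAt
  have h2 : HasMFDerivAt 𝓘(ℝ, ℂ) I (fun x => f (x + c)) 0
      ((mfderiv 𝓘(ℝ, ℂ) I f c).comp (ContinuousLinearMap.id ℝ ℂ)) :=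
    hg.comp 0 h1
  exact h2.mfderiv.trans (ContinuousLinearMap.ext fun v => rfl)

/-- Post-composition with a bijective real-linear self-map of `ℂ` does not change surjectivity. -/
theorem locIdx_surjective_comp_iff {S : ℂ →L[ℝ] ℂ} (hS : Bijective S) (L : ℂ →L[ℝ] ℂ) :
    Surjective (S.comp L) ↔ Surjective L := by
  refine ⟨fun h c => ?_, fun h => hS.2.comp h⟩
  obtain ⟨v, hv⟩ := h (S c)
  exact ⟨v, hS.1 hv⟩

/-- A real-linear self-map of `ℂ` with non-zero determinant is bijective. -/
theorem locIdx_bijective_of_det_ne_zero (R : ℂ →L[ℝ] ℂ)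
    (h : LinearMap.det (R : ℂ →ₗ[ℝ] ℂ) ≠ 0) : Bijective R :=
  (Module.End.isUnit_iff _).1 ((LinearMap.isUnit_iff_isUnit_det (R : ℂ →ₗ[ℝ] ℂ)).2 h.isUnit)

/-- The complex conjugate of a loop avoiding `0` is a loop avoiding `0`. -/
theorem locIdx_loop_conj {γ : ℝ → ℂ} (hγ : IsNonvanishingLoop γ) :
    IsNonvanishingLoop (fun t => conj (γ t)) :=
  ⟨Complex.continuous_conj.comp_continuousOn hγ.continuousOn,
    fun t ht => (map_ne_zero _).2 (hγ.ne_zero t ht), by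
      show conj (γ 0) = conj (γ 1)
      rw [hγ.eq_endpoints]⟩

/-- **Normalisation with sign.**  For a real-linear surjection `ℓ : ℝ⁴ → ℂ` with `J`-invariant
kernel (`J² = -1`) there is a real-linear bijection `S` of `ℂ` making `S ∘ ℓ` complex-linear for
`J`, which EITHER preserves winding numbers, and then every preimage `ξ` of `1` has
`0 < Im (ℓ (J ξ))`, OR reverses them, and then every preimage `ξ` of `1` has `Im (ℓ (J ξ)) < 0`. -/
theorem locIdx_normalise (ℓ : EuclideanSpace ℝ (Fin 4) →L[ℝ] ℂ)
    (J : EuclideanSpace ℝ (Fin 4) →L[ℝ] EuclideanSpace ℝ (Fin 4))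
    (hJ : ∀ v, J (J v) = -v) (hℓ : Surjective ℓ) (hker : ∀ v, ℓ v = 0 → ℓ (J v) = 0) :
    ∃ S : ℂ →L[ℝ] ℂ, Bijective S ∧ (∀ v, S (ℓ (J v)) = Complex.I * S (ℓ v)) ∧
      (((∀ γ : ℝ → ℂ, IsNonvanishingLoop γ → wind (fun t => S (γ t)) = wind γ) ∧
          ∀ ξ, ℓ ξ = 1 → 0 < (ℓ (J ξ)).im) ∨
        ((∀ γ : ℝ → ℂ, IsNonvanishingLoop γ → wind (fun t => S (γ t)) = -wind γ) ∧
          ∀ ξ, ℓ ξ = 1 → (ℓ (J ξ)).im < 0)) := by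
  obtain ⟨ξ₀, hξ₀⟩ := hℓ 1
  have hne : (ℓ (J ξ₀)).im ≠ 0 := (helper_orientationSign_basic ℓ J ξ₀ ξ₀ hJ hℓ hker hξ₀ hξ₀).2
  have hind : ∀ ξ, ℓ ξ = 1 → ℓ (J ξ) = ℓ (J ξ₀) := fun ξ hξ =>
    (helper_orientationSign_basic ℓ J ξ ξ₀ hJ hℓ hker hξ hξ₀).1
  rcases lt_or_gt_of_ne hne with hneg | hpos
  · -- negative sign: conjugate first
    set ℓ' : EuclideanSpace ℝ (Fin 4) →L[ℝ] ℂ :=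
      (Complex.conjCLE : ℂ ≃L[ℝ] ℂ).toContinuousLinearMap.comp ℓ
    have happ : ∀ v, ℓ' v = conj (ℓ v) := fun v => rfl
    have h1 : ℓ' ξ₀ = 1 := by rw [happ, hξ₀, map_one]
    have hs : Surjective ℓ' := Complex.conjCLE.surjective.comp hℓ
    have hk : ∀ v, ℓ' v = 0 → ℓ' (J v) = 0 := fun v hv => by
      rw [happ, map_eq_zero] at hv ⊢
      exact hker v hv
    have hp : 0 < (ℓ' (J ξ₀)).im := by
      rw [happ, Complex.conj_im]
      linarith
    obtain ⟨R, hdet, hR⟩ := helper_normalise_posDet ℓ' J ξ₀ hJ hs hk h1 hp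
    have hRb : Bijective R := locIdx_bijective_of_det_ne_zero R hdet.ne'
    refine ⟨R.comp (Complex.conjCLE : ℂ ≃L[ℝ] ℂ).toContinuousLinearMap, ?_, fun v => hR v,
      Or.inr ⟨fun γ hγ => ?_, fun ξ hξ => ?_⟩⟩
    · exact hRb.comp Complex.conjCLE.bijective
    · show wind (fun t => R (conj (γ t))) = -wind γ
      rw [helper_wind_comp_posDet R _ (locIdx_loop_conj hγ) hdet, helper_wind_conj γ hγ]
    · rw [hind ξ hξ]
      exact hneg
  · obtain ⟨R, hdet, hR⟩ := helper_normalise_posDet ℓ J ξ₀ hJ hℓ hker hξ₀ hpos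
    refine ⟨R, locIdx_bijective_of_det_ne_zero R hdet.ne', hR,
      Or.inl ⟨fun γ hγ => helper_wind_comp_posDet R γ hγ hdet, fun ξ hξ => ?_⟩⟩
    rw [hind ξ hξ]
    exact hpos

/-! ### The application of positivity of intersections -/

/-- **Positivity of intersections at the origin, with a normalised leaf coordinate.**  The
vendored fact `positivityOfIntersections_leafCoordinate` applied to the curve `u₀`, the immersed
curve `w₀` with `u₀ 0 = w₀ 0 = y` whose image is, near `y`, the zero set `P` of the submersion `π`
on the open `N`, and the leaf coordinate `a := S ∘ π` for a real-linear bijection `S` of `ℂ`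
making `da_y` complex-linear; the conclusion is rewritten in terms of `π`, `P` and the loops
`t ↦ π (u₀ (circleLoop 0 r t))`. -/
theorem locIdx_F3 {X : Type} [TopologicalSpace X] [T2Space X] [SecondCountableTopology X]
    [ChartedSpace (EuclideanSpace ℝ (Fin 4)) X] [IsManifold (𝓡 4) ∞ X]
    (JX : AlmostComplexStructure (𝓡 4) ∞ X) (hF3 : positivityOfIntersections_leafCoordinate)
    {u₀ w₀ : ℂ → X} {N P W' : Set X} {π : X → ℂ} {y : X} (S : ℂ →L[ℝ] ℂ)
    (hu : ContMDiff 𝓘(ℝ, ℂ) (𝓡 4) ∞ u₀) (hJu : IsJHolomorphic (𝓡 4) (fun x => JX x) u₀)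
    (hw : ContMDiff 𝓘(ℝ, ℂ) (𝓡 4) ∞ w₀) (hJw : IsJHolomorphic (𝓡 4) (fun x => JX x) w₀)
    (huy : u₀ 0 = y) (hwy : w₀ 0 = y) (himm : Injective (mfderiv 𝓘(ℝ, ℂ) (𝓡 4) w₀ 0))
    (hN : IsOpen N) (hπ : ContMDiffOn (𝓡 4) 𝓘(ℝ, ℂ) ∞ π N)
    (hsub : ∀ x ∈ N, Surjective (mfderiv (𝓡 4) 𝓘(ℝ, ℂ) π x))
    (hP : {x | x ∈ N ∧ π x = 0} = P) (hW'o : IsOpen W') (hyW' : y ∈ W')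
    (hPW' : P ∩ W' = range w₀) (hSb : Bijective S)
    (hSJ : ∀ v : TangentSpace (𝓡 4) y, S (mfderiv (𝓡 4) 𝓘(ℝ, ℂ) π y (JX y v)) =
      Complex.I * S (mfderiv (𝓡 4) 𝓘(ℝ, ℂ) π y v)) :
    (∀ᶠ w in 𝓝 (0 : ℂ), u₀ w ∈ P) ∨
    ∃ r₀ : ℝ, 0 < r₀ ∧ (∀ w : ℂ, 0 < ‖w‖ → ‖w‖ ≤ r₀ → u₀ w ∈ N ∧ u₀ w ∉ P) ∧
      ∀ r : ℝ, 0 < r → r ≤ r₀ →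
        IsNonvanishingLoop (fun t => π (u₀ (circleLoop 0 r t))) ∧
        1 ≤ wind (fun t => S (π (u₀ (circleLoop 0 r t)))) ∧
        (wind (fun t => S (π (u₀ (circleLoop 0 r t)))) = 1 ↔
          Surjective (mfderiv 𝓘(ℝ, ℂ) 𝓘(ℝ, ℂ) (π ∘ u₀) 0)) := by
  subst hwy
  -- the point `y = w₀ 0` lies on `P ⊆ N`, and `π` vanishes on `P`
  have hPN : ∀ x ∈ P, x ∈ N := fun x hx => ((Set.ext_iff.1 hP x).2 hx).1
  have hPπ : ∀ x ∈ P, π x = 0 := fun x hx => ((Set.ext_iff.1 hP x).2 hx).2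
  have hyP : w₀ 0 ∈ P := by
    have h : w₀ 0 ∈ P ∩ W' := by
      rw [hPW']
      exact mem_range_self 0
    exact h.1
  have hyN : w₀ 0 ∈ N := hPN _ hyP
  have hu0N : u₀ 0 ∈ N := huy ▸ hyN
  have hS0 : ∀ c : ℂ, S c = 0 ↔ c = 0 := fun c =>
    ⟨fun h => hSb.1 (h.trans (map_zero S).symm), fun h => by rw [h, map_zero]⟩
  -- the leaf coordinate `a := S ∘ π`: smooth on `N`, differential `S ∘ dπ`, submersive
  have ha_smooth : ContMDiffOn (𝓡 4) 𝓘(ℝ, ℂ) ∞ (fun x => S (π x)) N :=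
    S.contMDiff.comp_contMDiffOn hπ
  have ha_der : ∀ x ∈ N, HasMFDerivAt (𝓡 4) 𝓘(ℝ, ℂ) (fun x => S (π x)) x
      (S.comp (mfderiv (𝓡 4) 𝓘(ℝ, ℂ) π x)) := fun x hx =>
    (hasMFDerivAt_iff_hasFDerivAt.2 S.hasFDerivAt).comp x
      ((hπ.contMDiffAt (hN.mem_nhds hx)).mdifferentiableAt (by simp)).hasMFDerivAt
  have ha_app : ∀ x ∈ N, ∀ v : TangentSpace (𝓡 4) x,
      mfderiv (𝓡 4) 𝓘(ℝ, ℂ) (fun x => S (π x)) x v = S (mfderiv (𝓡 4) 𝓘(ℝ, ℂ) π x v) :=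
    fun x hx v => by
    rw [(ha_der x hx).mfderiv]
    rfl
  have ha_surj : ∀ x ∈ N, Surjective (mfderiv (𝓡 4) 𝓘(ℝ, ℂ) (fun x => S (π x)) x) :=
    fun x hx => by
    rw [(ha_der x hx).mfderiv]
    exact hSb.2.comp (hsub x hx)
  -- its zero set near `y` is the image of `w₀`
  have hzero : ∃ V ∈ 𝓝 (0 : ℂ), ∃ W ∈ 𝓝 (w₀ 0), W ⊆ N ∧
      {x | x ∈ W ∧ S (π x) = 0} = w₀ '' V := by
    refine ⟨univ, univ_mem, W' ∩ N, (hW'o.inter hN).mem_nhds ⟨hyW', hyN⟩, inter_subset_right, ?_⟩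
    rw [image_univ, ← hPW']
    ext x
    simp only [mem_setOf_eq, mem_inter_iff, hS0]
    constructor
    · rintro ⟨⟨hxW, hxN⟩, hx0⟩
      refine ⟨?_, hxW⟩
      rw [← hP]
      exact ⟨hxN, hx0⟩
    · rintro ⟨hxP, hxW⟩
      exact ⟨⟨hxW, hPN x hxP⟩, hPπ x hxP⟩
  -- and its differential at `y` is complex-linear
  have haJ : ∀ v : TangentSpace (𝓡 4) (w₀ 0),
      (show ℂ from mfderiv (𝓡 4) 𝓘(ℝ, ℂ) (fun x => S (π x)) (w₀ 0) (JX (w₀ 0) v)) =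
        Complex.I * (show ℂ from mfderiv (𝓡 4) 𝓘(ℝ, ℂ) (fun x => S (π x)) (w₀ 0) v) := by
    intro v
    dsimp only
    rw [ha_app _ hyN, ha_app _ hyN]
    exact hSJ v
  -- positivity of intersections
  have key : (∀ᶠ z in 𝓝 (0 : ℂ), u₀ z ∈ N ∧ S (π (u₀ z)) = 0) ∨
      (∃ r₀ : ℝ, 0 < r₀ ∧ (∀ z : ℂ, 0 < ‖z‖ → ‖z‖ ≤ r₀ → u₀ z ∈ N ∧ S (π (u₀ z)) ≠ 0) ∧
        (∀ r : ℝ, 0 < r → r ≤ r₀ → 1 ≤ wind (fun t => S (π (u₀ (circleLoop 0 r t))))) ∧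
        (∀ r : ℝ, 0 < r → r ≤ r₀ → (wind (fun t => S (π (u₀ (circleLoop 0 r t)))) = 1 ↔
          Surjective (mfderiv 𝓘(ℝ, ℂ) 𝓘(ℝ, ℂ) ((fun x => S (π x)) ∘ u₀) 0)))) :=
    hF3 X JX u₀ w₀ N (fun x => S (π x)) hu hJu hw hJw huy himm hN hyN ha_smooth ha_surj hzero haJ
  rcases key with h | ⟨r₀, hr₀, hpunct, hwind, hiff⟩
  · left
    refine h.mono fun w hw => ?_
    rw [← hP]
    exact ⟨hw.1, (hS0 _).1 hw.2⟩
  · right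
    refine ⟨r₀, hr₀, fun w h0 h1 => ⟨(hpunct w h0 h1).1, fun hwP =>
      (hpunct w h0 h1).2 ((hS0 _).2 (hPπ _ hwP))⟩, fun r hr hrr => ?_⟩
    -- the small circle stays in the punctured range
    have hn : ∀ t, ‖circleLoop 0 r t‖ = r := fun t => by
      rw [← sub_zero (circleLoop 0 r t), norm_circleLoop_sub_center, abs_of_pos hr]
    have hmem : ∀ t, u₀ (circleLoop 0 r t) ∈ N ∧ S (π (u₀ (circleLoop 0 r t))) ≠ 0 := fun t =>
      hpunct _ (by rw [hn]; exact hr) (by rw [hn]; exact hrr)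
    have hγ : IsNonvanishingLoop (fun t => π (u₀ (circleLoop 0 r t))) :=
      ⟨(hπ.continuousOn.comp_continuous (hu.continuous.comp (continuous_circleLoop 0 r))
          fun t => (hmem t).1).continuousOn,
        fun t _ h0 => (hmem t).2 ((hS0 _).2 h0), by
          show π (u₀ (circleLoop 0 r 0)) = π (u₀ (circleLoop 0 r 1))
          rw [circleLoop_zero_eq]⟩
    refine ⟨hγ, hwind r hr hrr, (hiff r hr hrr).trans ?_⟩
    -- `d(S ∘ π ∘ u₀)_0 = S ∘ d(π ∘ u₀)_0`, and `S` is bijective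
    have hd : MDifferentiableAt 𝓘(ℝ, ℂ) 𝓘(ℝ, ℂ) (π ∘ u₀) 0 :=
      ((hπ.contMDiffAt (hN.mem_nhds hu0N)).mdifferentiableAt (by simp)).comp 0
        (hu.mdifferentiableAt (by simp))
    have hcomp : HasMFDerivAt 𝓘(ℝ, ℂ) 𝓘(ℝ, ℂ) ((fun x => S (π x)) ∘ u₀) 0
        (S.comp (mfderiv 𝓘(ℝ, ℂ) 𝓘(ℝ, ℂ) (π ∘ u₀) 0)) :=
      (hasMFDerivAt_iff_hasFDerivAt.2 S.hasFDerivAt).comp 0 hd.hasMFDerivAt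
    rw [hcomp.mfderiv]
    exact locIdx_surjective_comp_iff hSb _

/-- **The local index with a normalised witness, at an arbitrary point.**  `locIdx_F3` for the
translated curves `w ↦ u (w + z)` and `w ↦ u' (w + z')` through the point `u z = u' z'` of the
embedded sphere `(u', v')` with normal witness `(N, π)` and the local-image property at `z'`,
transported back to `z`. -/
theorem locIdx_core {X : Type} [TopologicalSpace X] [T2Space X] [SecondCountableTopology X]
    [ChartedSpace (EuclideanSpace ℝ (Fin 4)) X] [IsManifold (𝓡 4) ∞ X]
    (JX : AlmostComplexStructure (𝓡 4) ∞ X) (hF3 : positivityOfIntersections_leafCoordinate)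
    {u u' v' : ℂ → X} {N : Set X} {π : X → ℂ} {z z' : ℂ}
    (hu : ContMDiff 𝓘(ℝ, ℂ) (𝓡 4) ∞ u) (hJu : IsJHolomorphic (𝓡 4) (fun y => JX y) u)
    (hS : TwoChartSphere (fun y => JX y) u' v') (hE : IsEmbeddedPair u' v')
    (hW : IsNormalWitness N π u' v')
    (hloc : ∀ V : Set ℂ, IsOpen V → z' ∈ V →
      ∃ W : Set X, IsOpen W ∧ u' z' ∈ W ∧ pairImage u' v' ∩ W = u' '' V)
    (hzz : u z = u' z') (S : ℂ →L[ℝ] ℂ) (hSb : Bijective S)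
    (hSJ : ∀ v : TangentSpace (𝓡 4) (u' z'), S (mfderiv (𝓡 4) 𝓘(ℝ, ℂ) π (u' z') (JX (u' z') v)) =
      Complex.I * S (mfderiv (𝓡 4) 𝓘(ℝ, ℂ) π (u' z') v)) :
    (∀ᶠ w in 𝓝 z, u w ∈ pairImage u' v') ∨
    ∃ r₀ : ℝ, 0 < r₀ ∧
      (∀ w : ℂ, 0 < ‖w - z‖ → ‖w - z‖ ≤ r₀ → u w ∈ N ∧ u w ∉ pairImage u' v') ∧
      ∀ r : ℝ, 0 < r → r ≤ r₀ →
        IsNonvanishingLoop (fun t => π (u (circleLoop z r t))) ∧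
        1 ≤ wind (fun t => S (π (u (circleLoop z r t)))) ∧
        (wind (fun t => S (π (u (circleLoop z r t)))) = 1 ↔
          Surjective (mfderiv 𝓘(ℝ, ℂ) 𝓘(ℝ, ℂ) (π ∘ u) z)) := by
  have hyN : u' z' ∈ N := hW.image_subset (Or.inl (mem_range_self z'))
  have hzN : u z ∈ N := hzz ▸ hyN
  -- the translated curves (`…WitnessCharge.PencilIncompleteness.contMDiff_comp_add_const` etc.)
  have hu₀ : ContMDiff 𝓘(ℝ, ℂ) (𝓡 4) ∞ (fun w => u (w + z)) := contMDiff_comp_add_const hu z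
  have hJu₀ : IsJHolomorphic (𝓡 4) (fun y => JX y) (fun w => u (w + z)) :=
    isJHolomorphic_comp_add_const hu hJu z
  have hw₀ : ContMDiff 𝓘(ℝ, ℂ) (𝓡 4) ∞ (fun w => u' (w + z')) :=
    contMDiff_comp_add_const hS.smooth_u z'
  have hJw₀ : IsJHolomorphic (𝓡 4) (fun y => JX y) (fun w => u' (w + z')) :=
    isJHolomorphic_comp_add_const hS.smooth_u hS.hol_u z'
  have huy : (fun w => u (w + z)) 0 = u' z' := by
    simp only [zero_add]
    exact hzz
  have hwy : (fun w => u' (w + z')) 0 = u' z' := by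
    simp only [zero_add]
  have himm : Injective (mfderiv 𝓘(ℝ, ℂ) (𝓡 4) (fun w => u' (w + z')) 0) := by
    rw [locIdx_mfderiv_shift u' z' (hS.smooth_u.mdifferentiableAt (by simp))]
    exact hE.imm_u z'
  -- the local image of the sphere at `z'`
  obtain ⟨W', hW'o, hyW', hW'eq⟩ := hloc univ isOpen_univ (mem_univ _)
  have hPW' : pairImage u' v' ∩ W' = range (fun w => u' (w + z')) := by
    rw [hW'eq, image_univ]
    ext x
    constructor
    · rintro ⟨w, rfl⟩
      exact ⟨w - z', by simp only [sub_add_cancel]⟩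
    · rintro ⟨w, rfl⟩
      exact ⟨w + z', rfl⟩
  have key : (∀ᶠ w in 𝓝 (0 : ℂ), u (w + z) ∈ pairImage u' v') ∨
      ∃ r₀ : ℝ, 0 < r₀ ∧
        (∀ w : ℂ, 0 < ‖w‖ → ‖w‖ ≤ r₀ → u (w + z) ∈ N ∧ u (w + z) ∉ pairImage u' v') ∧
        ∀ r : ℝ, 0 < r → r ≤ r₀ →
          IsNonvanishingLoop (fun t => π (u (circleLoop 0 r t + z))) ∧
          1 ≤ wind (fun t => S (π (u (circleLoop 0 r t + z)))) ∧
          (wind (fun t => S (π (u (circleLoop 0 r t + z)))) = 1 ↔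
            Surjective (mfderiv 𝓘(ℝ, ℂ) 𝓘(ℝ, ℂ) (π ∘ fun w => u (w + z)) 0)) :=
    locIdx_F3 JX hF3 S hu₀ hJu₀ hw₀ hJw₀ huy hwy himm hW.isOpen hW.smooth hW.submersive
      (hW.zeroSet_eq.trans (pairImage_eq u' v').symm) hW'o hyW' hPW' hSb hSJ
  -- transport back from `0` to `z`
  have hd : MDifferentiableAt 𝓘(ℝ, ℂ) 𝓘(ℝ, ℂ) (π ∘ u) z :=
    ((hW.smooth.contMDiffAt (hW.isOpen.mem_nhds hzN)).mdifferentiableAt (by simp)).comp z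
      (hu.mdifferentiableAt (by simp))
  have e1 : mfderiv 𝓘(ℝ, ℂ) 𝓘(ℝ, ℂ) (π ∘ fun w => u (w + z)) 0 =
      mfderiv 𝓘(ℝ, ℂ) 𝓘(ℝ, ℂ) (π ∘ u) z :=
    locIdx_mfderiv_shift (π ∘ u) z hd
  simp only [circleLoop_zero_add z] at key
  rcases key with h | ⟨r₀, hr₀, hp, hr⟩
  · left
    have ht : Tendsto (fun w : ℂ => w - z) (𝓝 z) (𝓝 0) := tendsto_sub_nhds_zero_iff.2 tendsto_id
    refine (ht.eventually h).mono fun w hw => ?_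
    simpa only [sub_add_cancel] using hw
  · right
    refine ⟨r₀, hr₀, fun w h0 h1 => ?_, fun r hr0 hrr => ?_⟩
    · have h := hp (w - z) h0 h1
      rwa [sub_add_cancel] at h
    · obtain ⟨hγ, h1, h2⟩ := hr r hr0 hrr
      refine ⟨hγ, h1, h2.trans ?_⟩
      rw [e1]
      exact Iff.rfl

/-- J13: the SIGNED LOCAL INTERSECTION INDEX (positivity of intersections with the normal
witness of an embedded `JX`-sphere as leaf coordinate, normalised by an orientation-preserving
real-linear map): a smooth `JX`-holomorphic `u` through a point `u z = u' z'` of the sphere is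
either locally inside the sphere near `z`, or meets it isolatedly at `z` with winding number of
`π ∘ u` on small circles `= ε · n`, `n ≥ 1`, `n = 1` iff `d(π ∘ u)_z` is onto, where `ε = ±1` is the
orientation sign of `π` at the point. -/
theorem helper_localIndexSigned : ∀ (X : Type) [TopologicalSpace X] [T2Space X]
    [SecondCountableTopology X] [ChartedSpace (EuclideanSpace ℝ (Fin 4)) X] [IsManifold (𝓡 4) ∞ X]
    (JX : AlmostComplexStructure (𝓡 4) ∞ X),
    positivityOfIntersections_leafCoordinate →
    ∀ (u u' v' : ℂ → X) (N : Set X) (π : X → ℂ) (z z' : ℂ),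
    ContMDiff 𝓘(ℝ, ℂ) (𝓡 4) ∞ u → IsJHolomorphic (𝓡 4) (fun y => JX y) u →
    TwoChartSphere (fun y => JX y) u' v' → IsEmbeddedPair u' v' → IsNormalWitness N π u' v' →
    (∀ y ∈ N, ∀ ξ : TangentSpace (𝓡 4) y, mfderiv (𝓡 4) 𝓘(ℝ, ℂ) π y ξ = 0 →
      mfderiv (𝓡 4) 𝓘(ℝ, ℂ) π y (JX y ξ) = 0) →
    (∀ V : Set ℂ, IsOpen V → z' ∈ V →
      ∃ W : Set X, IsOpen W ∧ u' z' ∈ W ∧ pairImage u' v' ∩ W = u' '' V) →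
    u z = u' z' →
    (∀ᶠ w in 𝓝 z, u w ∈ pairImage u' v') ∨
    (∃ r₀ : ℝ, 0 < r₀ ∧
      (∀ w : ℂ, 0 < ‖w - z‖ → ‖w - z‖ ≤ r₀ → u w ∈ N ∧ u w ∉ pairImage u' v') ∧
      ∀ ξ : TangentSpace (𝓡 4) (u' z'), (show ℂ from mfderiv (𝓡 4) 𝓘(ℝ, ℂ) π (u' z') ξ) = 1 →
        (0 < (show ℂ from mfderiv (𝓡 4) 𝓘(ℝ, ℂ) π (u' z') (JX (u' z') ξ)).im →
          ∀ r : ℝ, 0 < r → r ≤ r₀ →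
            1 ≤ wind (fun t => π (u (circleLoop z r t))) ∧
            (wind (fun t => π (u (circleLoop z r t))) = 1 ↔
              Surjective (mfderiv 𝓘(ℝ, ℂ) 𝓘(ℝ, ℂ) (π ∘ u) z))) ∧
        ((show ℂ from mfderiv (𝓡 4) 𝓘(ℝ, ℂ) π (u' z') (JX (u' z') ξ)).im < 0 →
          ∀ r : ℝ, 0 < r → r ≤ r₀ →
            wind (fun t => π (u (circleLoop z r t))) ≤ -1 ∧
            (wind (fun t => π (u (circleLoop z r t))) = -1 ↔
              Surjective (mfderiv 𝓘(ℝ, ℂ) 𝓘(ℝ, ℂ) (π ∘ u) z)))) := by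
  intro X _ _ _ _ _ JX hF3 u u' v' N π z z' hu hJu hS hE hW hker hloc hzz
  have hyN : u' z' ∈ N := hW.image_subset (Or.inl (mem_range_self z'))
  -- normalise the witness differential at the point, keeping track of the sign
  obtain ⟨S, hSb, hSJ, hsign⟩ := locIdx_normalise (mfderiv (𝓡 4) 𝓘(ℝ, ℂ) π (u' z')) (JX (u' z'))
    (fun v => JX.map_map (u' z') v) (hW.submersive _ hyN) (hker _ hyN)
  rcases locIdx_core JX hF3 hu hJu hS hE hW hloc hzz S hSb hSJ with h | ⟨r₀, hr₀, hp, hr⟩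
  · exact Or.inl h
  · refine Or.inr ⟨r₀, hr₀, hp, fun ξ hξ => ?_⟩
    rcases hsign with ⟨hwS, hpos⟩ | ⟨hwS, hneg⟩
    · refine ⟨fun _ r hr0 hrr => ?_, fun him => absurd (hpos ξ hξ) (not_lt.2 (le_of_lt him))⟩
      obtain ⟨hγ, h1, h2⟩ := hr r hr0 hrr
      rw [hwS _ hγ] at h1 h2
      exact ⟨h1, h2⟩
    · refine ⟨fun him => absurd (hneg ξ hξ) (not_lt.2 (le_of_lt him)), fun _ r hr0 hrr => ?_⟩
      obtain ⟨hγ, h1, h2⟩ := hr r hr0 hrr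
      rw [hwS _ hγ] at h1 h2
      refine ⟨by omega, Iff.trans ⟨fun h => by omega, fun h => by omega⟩ h2⟩

end Summit.SmoothPoincare4.SmoothPoincare4.Theorems.GromovRecognitionRelEnd.CrossCapLaurent

end
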